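import Literature.NumberTheory.EllipticCurves.SteinWuthrich2013.MultiplicativeLeadingTerm
import Literature.NumberTheory.EllipticCurves.BSDRootNumberSmallConductorProofs
import HarnessLib

/-!
# Disegni 2020, Theorem 4 (second bullet) = Theorem 1 at a SPLIT multiplicative prime `p ≥ 5`, analytic
# rank one: the exceptional-zero `p`-adic Birch–Swinnerton-Dyer leading term with the ANALYTIC order of `Ш`

Topic `Literature/NumberTheory/EllipticCurves` (cluster `Disegni2020`; twin of
`Disegni2020/PAdicBSDRankLeOne.lean` = the NON-split clause; companions `PAdicBSD.lean`
(`PAdicBSDConjectureExceptional`, Mazur–Tate–Teitelbaum's exceptional-case conjecture, whose rank-one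
instance this file records AS A THEOREM with `#Ш` replaced by `#Ш_an`; `greenberg_stevens` = its rank-zero
instance), `SteinWuthrich2013/MultiplicativeLeadingTerm.lean` (THE §4.2 height at a split prime,
`IsSplitMultCanonical`, and `LInvariant`)). ONE named fact (nothing asserted). HONEST FRAMING (BSD
rank-≤1 residual cell `b2b-bsdres`, team `x11b3` = N8/O2, unit `b2b-bsdres-x11b3-p2`): the cell deletes
the COMBINATION-SHAPED residual classes of the rank-`≤ 1` BSD formula STRICTLY from published theorems
and TYPES the remainder; this file supplies, at a SPLIT multiplicative `p ≥ 5`, the published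
`p`-adic ∘ archimedean leading-term comparison that the cyclotomic route (X11B-AUDIT §3bis V4) consumes on
class X11b ∧ (ram) at `p ≥ 5` (row N8); it is not a class theorem and nothing here is "finishing BSD".

## Source (held: `paper:arxiv-1609.02528`, LaTeXML text; locators = chunk:line)

D. Disegni, *On the `p`-adic Birch and Swinnerton-Dyer conjecture for elliptic curves over number
fields*, Kyoto J. Math. **60** (2020) 473–510, doi:10.1215/21562261-2018-0012 (= arXiv:1609.02528).
REFEREED. The general setting, Hypotheses (`L_p`), (BSD_∞), the formula (BSD_p) of §1.1.4, `d^{r̃}`,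
`R̃_ℓ`, `|Ш|_an` are quoted in `Disegni2020/PAdicBSDRankLeOne.lean`; here only what the split case adds.

* `S_p^{exc}` = "the set of places above `p` over which `A` has split multiplicative reduction",
  `r̃ := r + |S_p^{exc}|` [p0004 L21–L27] — so `r̃ = r + 1` for `E/ℚ` split multiplicative at `p`;
  `ẽ_𝔭(𝟙) := ord_𝔭(q_{A,𝔭})⁻¹` for `𝔭 ∈ S_p^{exc}` [p0005 L22]; the `𝓛`-invariant
  "`𝓛_{𝔭,ℓ}(A) := ℓ_𝔭(q_{A,𝔭})/ord_𝔭(q_{A,𝔭}) ∈ Γ ⊗ ℚ_p`" [p0006 L2] (for `Γ = Γ_ℚ ≅ ℤ_p` via `γ ↦ 1`: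
  `log_p q_E/(ord_p q_E · log_p κ(γ))`, i.e. the tree's `LInvariant Dq = log_p q_E/ord_p q_E` divided by
  `log_p κ(γ)`); `L*_alg(A,1) := L^{(r)}(A,1)/(r! |D_K|^{-1/2} Ω_A R_NT(A))` [p0011 L12] (`R_NT` with
  torsion², Def. (def-reg)) and Proposition 2 [p0011 L16–L23]: (BSD_p) holds iff
  "`d^{r̃} L_p(A,𝟙) = ∏_{𝔭 ∉ S^{exc}} e_𝔭(𝟙) ∏_{𝔭 ∈ S^{exc}} 𝓛_{𝔭,ℓ_Γ}(A) · R^{norm}_{ℓ_Γ}(A) · L*_alg(A,1)`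
  in `Sym^{r̃} Γ ⊗ L`" ("closer to the original conjecture of Mazur–Tate–Teitelbaum", `R^{norm}` the
  regulator of the norm-adapted height `h^{norm}_ℓ` "following Schneider" [p0008 L40]).
* **Theorem 1** [p0005 L49–L57]: "Let `E/ℚ` be an elliptic curve of conductor `N` with ordinary reduction
  at the prime `p`. Suppose that `r_an := ord_{s=1} L(E,s) ≤ 1` and that (∗) if `r_an = 1` and
  `S_p^{exc}(E) ≠ ∅`, then `p ≥ 5` and there exists another prime `m ≠ p` of multiplicative reduction
  for `E`. Then Hypotheses (`L_p`) and (BSD_∞)–(BSD1)-(BSD2) are satisfied, and [the formula] (BSD_p)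
  holds." **Theorem 4**, second bullet [p0011 L66–L72]: "If `r = 1` and the reduction of `E` at `p` is
  split multiplicative, suppose that `p ≥ 5`. Then [(BSD_p)] holds up to a nonzero rational number; if
  moreover there is at least another prime `m ≠ p` of multiplicative reduction for `E`, then [(BSD_p)]
  holds exactly, that is `d² L_p(E,𝟙) = 𝓛_p(E) · R^{norm}(E) · L'_alg(E,1)` in `Γ_ℚ^{⊗2} ⊗ ℚ`."
* Proof, §3.2.2 [p0012 L14–L60]: "The result is proven by Venerucci [venerucci] up to a rational
  constant. We remove the ambiguity assuming the condition that `E` has a prime `m ≠ p` of multiplicative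
  reduction" — Proposition 4 (Venerucci) for the base change to an auxiliary imaginary quadratic `K`
  (`p`, `m` inert) and Proposition 5 (`δ(f) = δ(f′)/c_p(E)`, Ribet–Takahashi / Grothendieck's monodromy
  pairing). SOURCE OF THE SOURCE: R. Venerucci, *Exceptional zero formulae and a conjecture of
  Perrin-Riou*, Invent. Math. 203 (2016) 923–972 (`paper:arxiv-1407.1913`), standing hypotheses p0003
  L3–L7: "conductor `Np`, with `p > 3` a prime of split multiplicative reduction … Assume throughout this
  paper that the `p`-torsion subgroup `A_p` of `A(ℚ̄)` is an irreducible `𝔽_p[G_ℚ]`-module" — the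
  IRREDUCIBILITY OF `E[p]` is therefore carried below as an explicit hypothesis (NARROWER than Disegni's
  printed Thm. 4, faithful to its proof; flag candidate `Disegni2020-Thm4-irreducible-implicit`).

## Transcription (`thm4_padicBSD_splitMultiplicative_rankOne`), `K = ℚ`, `Γ = Γ_ℚ`, `T = γ - 1`

`W` globally minimal; `5 ≤ p`; split multiplicative reduction at `p` carried by the Tate datum
`Dq : TateParameterData W p` (field `split`; `q = q_E`); `E[p]` irreducible (Venerucci); a second prime
`m ≠ p` of multiplicative reduction (Disegni's exactness hypothesis; NO ramification condition on `m`);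
`ord_{s=1} L(E,s) = 1`; `Dh` THE §4.2 height at a split prime (`IsSplitMultCanonical Dh Dq` — Schneider's
norm-adapted height, SW §6.1 p. 20 / §4.2 p. 16 = Disegni's `h^{norm}`); `f` a newform of `E`; `L` THE
split Mazur–Tate–Teitelbaum function (`IsSplitMultPAdicLFunctionOf f p L`, `Ω⁺_f`-normalised, Disegni's
being `ϖ · L`, `ϖ · Ω_E = Ω⁺_f`, up to the involution `γ ↦ γ⁻¹` at most). CONCLUSION (`d² ↔ [T²]`,
`𝓛_{p,ℓ} ↔ 𝓛_p/log_p κ(γ)`, `R^{norm} ↔ Reg_p(E, Dh)/(log_p κ(γ) · #E(ℚ)_tors²)`, `L'_alg = s · ∏ c_v`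
with `s = #Ш_an` — exactly the dictionary of `PAdicBSDConjectureExceptional` / `thm61_splitMultiplicative`):
`rank E(ℚ) = 1 = r_an`; `ord_{T=0} L ≥ 2`; `#Ш(E)_an = s ∈ ℚ^×`; and
`ϖ · [T²]L · log_p(γ_cyc)² · #E(ℚ)_tors² = u · 𝓛_p(E) · s · Reg_p(E, Dh) · ∏_v c_v`, `u ∈ ℤ_pˣ`
(printed: exact equality in Nekovář's normalisation; "up to a unit" absorbs the sign conventions of the
height, of `γ` and of the Gauss sum and is implied by, never stronger than, the source). Nothing asserted.

## What is NOT here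

`r = 0` at a split prime (Greenberg–Stevens: the tree's `greenberg_stevens`); the "up to a nonzero
rational number" clause without `m`; `p ∈ {2, 3}` at a split prime (NOT covered by the source: (∗));
Theorem 2 / Theorem 8 (base change, several variables); the non-split clause (`PAdicBSDRankLeOne.lean`).

## References

* D. Disegni, Kyoto J. Math. 60 (2020), Thm. 1, Thm. 4, Prop. 2, §3.2.2 Props. 4–5 (`Disegni2020`).
  PRIMARY (LaTeXML of arXiv:1609.02528), read 2026-08-21.
* R. Venerucci, Invent. Math. 203 (2016) 923–972, §1 (standing hypotheses), Thm. A, Thm. C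
  (`Venerucci2016`, held `paper:arxiv-1407.1913`).
* B. Mazur, J. Tate, J. Teitelbaum, Invent. Math. 84 (1986) §II.10 (`MazurTateTeitelbaum1986`).
* W. Stein, C. Wuthrich, Math. Comp. 82 (2013) §3.4 (3.4), §4.2, §6.1 (`SteinWuthrich2013`).
-/

noncomputable section

open scoped Classical MatrixGroups ModularForm

open CongruenceSubgroup WeierstrassCurve Literature.NumberTheory.EllipticCurves.ModularForms
  Literature.NumberTheory.EllipticCurves.SteinWuthrich2013

namespace Literature.NumberTheory.EllipticCurves.Disegni2020

/-- **Disegni 2020, Theorem 4 (second bullet, exact form) at a SPLIT multiplicative prime `p ≥ 5`,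
analytic rank one — a THEOREM of the source.** As printed (Kyoto J. Math. 60 (2020), Thm. 4): "Let
`E/ℚ` be an elliptic curve with ordinary reduction at the prime `p`. Suppose that
`r := ord_{s=1} L(E,s) ≤ 1`. … If `r = 1` and the reduction of `E` at `p` is split multiplicative, suppose
that `p ≥ 5`. Then [(BSD_p)] holds up to a nonzero rational number; if moreover there is at least another
prime `m ≠ p` of multiplicative reduction for `E`, then [(BSD_p)] holds exactly, that is
`d² L_p(E,𝟙) = 𝓛_p(E) · R^{norm}(E) · L'_alg(E,1)` in `Γ_ℚ^{⊗2} ⊗ ℚ`", with `𝓛_p(E) = ℓ_p(q_E)/ord_p(q_E)`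
(§1.2.1), `R^{norm}` the regulator (torsion² included, Def. (def-reg)) of the norm-adapted height
"following Schneider" (§2.1), `L*_alg(E,1) = L'(E,1)/(Ω_E R_NT(E))` (§3.1); together with (BSD_p)'s order
clause "`L_p` vanishes at `𝟙` to order at least `r̃ = r + 1`" and Theorem 1's "(BSD_∞)(1)-(2) are
satisfied" (`rank = r_an`, `|Ш|_an ∈ ℚ^×`). Proof there (§3.2.2): Venerucci, Invent. Math. 203 (2016)
(Prop. 4) + Ribet–Takahashi (Prop. 5); Venerucci's standing hypothesis "`A_p` is an irreducible
`𝔽_p[G_ℚ]`-module" (loc. cit. §1) is carried here as an explicit hypothesis (narrower than the printed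
Thm. 4, faithful to its proof). Transcription for `K = ℚ` (module docstring): `W` globally minimal,
`5 ≤ p`, split multiplicative reduction carried by `Dq : TateParameterData W p`, `E[p]` irreducible, a
prime `m ≠ p` of multiplicative reduction, `ord_{s=1} L(E,s) = 1`, `Dh` THE Stein–Wuthrich §4.2 height at
the split prime (`IsSplitMultCanonical Dh Dq` = Schneider's norm-adapted height), `f` a newform of `E`,
`L` THE split Mazur–Tate–Teitelbaum function (`IsSplitMultPAdicLFunctionOf f p L`), `ϖ · Ω_E = Ω⁺_f`.
Conclusion: `rank E(ℚ) = r_an`; `ord_{T=0} L ≥ 2`; `#Ш(E)_an = s ∈ ℚ^×`; and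
`ϖ · [T²]L · log_p(γ_cyc)² · #E(ℚ)_tors² = u · 𝓛_p(E) · s · Reg_p(E, Dh) · ∏_v c_v` (`𝓛_p(E) = LInvariant Dq`),
`u ∈ ℤ_pˣ` (printed: exact; the unit absorbs sign conventions — implied by, never stronger than, the
source). Named fact (a published, refereed theorem); nothing asserted.
-- TODO(general form): the "up to ℚ^×" clause without `m`; Theorem 2/Theorem 8 over an imaginary
-- quadratic field (`1 + s` variables, two exceptional places). Only `K = ℚ`, `r_an = 1`, split `p ≥ 5`.
[cite: Disegni2020, Thm. 4 (second bullet) and §3.2.2 Props. 4–5, Thm. 1 (§1.2), Prop. 2 (§3.1), formula (BSD_p) of §1.1.4]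
[cite: Venerucci2016, §1 (standing hypotheses p. 1) and Thm. A, Thm. C]
[cite: SteinWuthrich2013, §3.4 eq. (3.4), §4.2 (p. 16) and §6.1 (p. 20)] -/
def thm4_padicBSD_splitMultiplicative_rankOne : Prop :=
  ∀ (W : WeierstrassCurve ℚ) [W.IsElliptic] [W.IsGloballyMinimal] (p : ℕ) [Fact p.Prime],
    5 ≤ p → ∀ (Dq : TateParameterData W p), W.HasIrreducibleModPGaloisRep p →
    (∃ m : ℕ, ∃ _ : Fact m.Prime, m ≠ p ∧ W.HasMultiplicativeReductionAtPrime m) →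
    W.analyticRank = 1 →
    ∀ (Dh : PAdicHeightData W p), IsSplitMultCanonical Dh Dq →
    ∀ ⦃N : ℕ⦄ [NeZero N] (f : CuspForm (Gamma0 N) 2), IsNewformOf W f →
    ∀ (L : PowerSeries ℚ_[p]), IsSplitMultPAdicLFunctionOf f p L →
    ∀ (ϖ : ℚ), (ϖ : ℝ) * W.realPeriodRat = plusPeriod f →
      W.mordellWeilRank = W.analyticRank ∧
      (((W.analyticRank + 1 : ℕ)) : ℕ∞) ≤ L.order ∧
      ∃ (s : ℚ) (u : ℤ_[p]ˣ), shaAn W = (s : ℂ) ∧ s ≠ 0 ∧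
        (ϖ : ℚ_[p]) * PowerSeries.coeff (W.analyticRank + 1) L *
            padicLog p (cyclotomicGenerator p) ^ (W.analyticRank + 1) * (W.torsionOrder : ℚ_[p]) ^ 2 =
          ((u : ℤ_[p]) : ℚ_[p]) *
            (LInvariant Dq * ((s : ℚ_[p]) * padicRegulator Dh * W.tamagawaProduct))

end Literature.NumberTheory.EllipticCurves.Disegni2020

end
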